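import Literature.Barriers.ValiantsHypothesis.CKRST20NaturalProofsExist
import Literature.RingTheory.MvPolynomial.PolynomialImageGridCount
import HarnessLib

/-!
# CKRST 2020 ‹Lemma 21› (= [HY11a, Claim 3.6] at `V = 𝔸^k`) — discharge of the named fact
# `CKRST2020_lemma21_affineSpace`

Theorem-only companion of `CKRST20NaturalProofsExist.lean` (cell val-lit t13; honest framing:
`VP ≠ VNP` is NOT proved, this is literature bookkeeping). The residual named fact
`Literature.Barriers.ValiantsHypothesis.CKRST2020_lemma21_affineSpace` — "for a polynomial map
`F = (F_1, …, F_m) : ℂ^k → ℂ^m` of degree `≤ d` and a finite `Δ ⊂ ℤ`,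
`|F(ℂ^k) ∩ Δ^m| ≤ (|Δ| · d)^k`" ([CKRST20, v2 ‹Lemma 21› = ECCC Lemma 4.1], the case `V = 𝔸^k`,
`r = 1` of [HY11a, Claim 3.6]) — is PROVED here (`CKRST2020_lemma21_affineSpace_holds`) from the
tree's general point count
`Literature.RingTheory.MvPolynomial.card_piFinset_filter_image_le_pow`
(`PolynomialImageGridCount.lean`: Hrubeš–Yehudayoff's induction on the dimension run on homogeneous
primes of `K[X_0, …, X_k]` with the Hilbert-polynomial form of Bézout's inequality, valid over any
infinite field). No new definitions, no new facts.

## References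

* P. Chatterjee, M. Kumar, C. Ramya, R. Saptharishi, A. Tengse, *On the existence of algebraically
  natural proofs*, FOCS 2020 / arXiv:2004.14147, v2 ‹Lemma 21› (ECCC TR20-063 Lemma 4.1).
  [ChatterjeeKumarRamyaSaptharishiTengse2020]
* P. Hrubeš, A. Yehudayoff, *Arithmetic complexity in ring extensions*, Theory of Computing 7
  (2011) 119–129, Lemma 3.5, Claim 3.6. [HrubesYehudayoff2011]
-/

noncomputable section

namespace Literature.Barriers.ValiantsHypothesis

open MvPolynomial

/-- **CKRST 2020 ‹Lemma 21› at `V = 𝔸^k` holds**: `|F(ℂ^k) ∩ Δ^m| ≤ (|Δ| · d)^k` for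
`F : ℂ^k → ℂ^m` polynomial of degree `≤ d`, `d ≥ 1`, `Δ ⊂ ℤ` finite non-empty — discharge of the
named fact `CKRST2020_lemma21_affineSpace` by
`Literature.RingTheory.MvPolynomial.card_piFinset_filter_image_le_pow` with `T = Δ ⊂ ℂ`
(`|T| = |Δ|` as `ℤ → ℂ` is injective).
[cite: ChatterjeeKumarRamyaSaptharishiTengse2020, Lemma 4.1 (ECCC) = v2 ‹Lemma 21›] -/
theorem CKRST2020_lemma21_affineSpace_holds : CKRST2020_lemma21_affineSpace := by
  intro k m d F Δ hΔ hd hF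
  classical
  set T : Finset ℂ := Δ.image fun z : ℤ => (z : ℂ) with hTdef
  have hTcard : T.card = Δ.card := Finset.card_image_of_injective _ Int.cast_injective
  have hT : T.Nonempty := hΔ.image _
  have h := Literature.RingTheory.MvPolynomial.card_piFinset_filter_image_le_pow
    (F := F) hT hd hF
  have hset : {v : Fin m → ℂ | (∀ i, ∃ z ∈ Δ, v i = (z : ℂ)) ∧
      ∃ y : Fin k → ℂ, ∀ i, eval y (F i) = v i} =
      ↑((Fintype.piFinset fun _ : Fin m => T).filter
        fun v => ∃ y : Fin k → ℂ, ∀ i, MvPolynomial.eval y (F i) = v i) := by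
    ext v
    simp only [Set.mem_setOf_eq, Finset.coe_filter, Fintype.mem_piFinset, hTdef, Finset.mem_image]
    constructor
    · rintro ⟨h1, h2⟩
      exact ⟨fun i => by obtain ⟨z, hz, hvz⟩ := h1 i; exact ⟨z, hz, hvz.symm⟩, h2⟩
    · rintro ⟨h1, h2⟩
      exact ⟨fun i => by obtain ⟨z, hz, hvz⟩ := h1 i; exact ⟨z, hz, hvz.symm⟩, h2⟩
  rw [hset, Set.encard_coe_eq_coe_finsetCard, ← hTcard]
  exact_mod_cast h

end Literature.Barriers.ValiantsHypothesis

end
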